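import Summits.MatrixMultiplication.OmegaCensus.DominoStructureChar
import HarnessLib

/-!
# Structure theorem for domino cube law triples — additive form

ω-census `pub-omega`, family (b3), seat pub-omega-group gen 6.  Framing: lottery ticket; floor = certified bounds/negative
ranges.  VALUE: a theorem about the group-theoretic method (TPP triples in dihedral-like groups); NOT progress on ω.

The additive system behind every law-attaining TPP triple of coset-part shape `(1,1 | d,d | e,e)` in a dihedral-like group
over a finite abelian group `A` (`|A| = 3de + 1`; `DominoTPPPacking.lean`, `DominoStructureTPP.lean`): sets `T₀, T₁` of
size `d` and `U₀, U₁` of size `e` whose four sumsets `Tᵢ + Uⱼ` are direct, with `T₀+U₀, T₁+U₀, T₀+U₁` pairwise disjoint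
and `T₁+U₁, T₀+U₁, T₁+U₀` pairwise disjoint (two near-tilings of `A`).

**Theorem (`domino_structure`).** If `3 ∤ |A|` then `T₁ = κ − T₀` and `U₁ = κ′ − U₀` for some `κ, κ′ ∈ A` — the
"structure conjecture" of the cell's gen-4 notes, for all domino cube shapes; it reduces the classification of these law
shapes to the symmetric near-factorisation `(X + Y) ⊔ (κ − X + Y) ⊔ (κ′ + X − Y) = A ∖ {pt}`.

Proof: the difference sets `Uⱼ − Tᵢ` pack in the same pattern (`disjoint_diff_of_disjoint_sum`), so all four near-tilings
give unit equations at every non-trivial character, and `domino_structure_of_charsums` applies.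
-/

namespace Summit.MatrixMultiplication.OmegaCensus

open Finset

section Additive

variable {A : Type*} [AddCommGroup A] [Fintype A] [DecidableEq A]

omit [Fintype A] in
/-- Character sum of a direct sumset `X + Y`. [folklore] -/
theorem charsum_sumset₂ (ψ : AddChar A ℂ) {X Y : Finset A}
    (hinj : Set.InjOn (fun p : A × A => p.1 + p.2) ↑(X ×ˢ Y)) :
    ∑ z ∈ (X ×ˢ Y).image (fun p : A × A => p.1 + p.2), ψ z = (∑ x ∈ X, ψ x) * (∑ y ∈ Y, ψ y) := by
  rw [sum_image hinj, sum_product, sum_mul_sum]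
  exact sum_congr rfl fun x _ => sum_congr rfl fun y _ => AddChar.map_add_eq_mul ψ x y

omit [Fintype A] [DecidableEq A] in
/-- Directness of `X + Y` gives directness of `Y − X`. [folklore] -/
theorem injOn_diff_of_injOn_sum {X Y : Finset A} (hinj : Set.InjOn (fun p : A × A => p.1 + p.2) ↑(X ×ˢ Y)) :
    Set.InjOn (fun p : A × A => p.1 - p.2) ↑(Y ×ˢ X) := by
  rintro ⟨y, x⟩ h ⟨y', x'⟩ h' he
  simp only [coe_product, Set.mem_prod, mem_coe] at h h'
  change y - x = y' - x' at he
  have key : x' + y = x + y' := by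
    calc x' + y = y - x + x + x' := by abel
      _ = y' - x' + x + x' := by rw [he]
      _ = x + y' := by abel
  have hm : (x', y) ∈ (↑(X ×ˢ Y) : Set (A × A)) := by simp [h'.2, h.1]
  have hm' : (x, y') ∈ (↑(X ×ˢ Y) : Set (A × A)) := by simp [h'.1, h.2]
  have := hinj hm hm' key
  simp only [Prod.mk.injEq] at this
  obtain ⟨hx, hy⟩ := this
  rw [hx, hy]

omit [Fintype A] in
/-- Character sum of a direct difference set `Y − X`: `υ · τ̄`. [folklore] -/
theorem charsum_diffset₂ (ψ : AddChar A ℂ) {X Y : Finset A}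
    (hinj : Set.InjOn (fun p : A × A => p.1 + p.2) ↑(X ×ˢ Y)) :
    ∑ z ∈ (Y ×ˢ X).image (fun p : A × A => p.1 - p.2), ψ z = (∑ y ∈ Y, ψ y) * (∑ x ∈ X, ψ (-x)) := by
  rw [sum_image (injOn_diff_of_injOn_sum hinj), sum_product, sum_mul_sum]
  exact sum_congr rfl fun y _ => sum_congr rfl fun x _ => by
    rw [sub_eq_add_neg, AddChar.map_add_eq_mul]

omit [Fintype A] in
/-- Size of a direct sumset. [folklore] -/
theorem card_sumset₂ {X Y : Finset A} (hinj : Set.InjOn (fun p : A × A => p.1 + p.2) ↑(X ×ˢ Y)) :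
    ((X ×ˢ Y).image (fun p : A × A => p.1 + p.2)).card = X.card * Y.card := by
  rw [card_image_of_injOn hinj, card_product]

omit [Fintype A] in
/-- Size of a direct difference set. [folklore] -/
theorem card_diffset₂ {X Y : Finset A} (hinj : Set.InjOn (fun p : A × A => p.1 + p.2) ↑(X ×ˢ Y)) :
    ((Y ×ˢ X).image (fun p : A × A => p.1 - p.2)).card = X.card * Y.card := by
  rw [card_image_of_injOn (injOn_diff_of_injOn_sum hinj), card_product, mul_comm]

omit [Fintype A] in
/-- Disjointness transfers from sumsets to difference sets: if `X′ + Y` and `X + Y′` are disjoint then so are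
`Y − X` and `Y′ − X′`. [folklore] -/
theorem disjoint_diff_of_disjoint_sum {X X' Y Y' : Finset A}
    (h : Disjoint ((X' ×ˢ Y).image (fun p : A × A => p.1 + p.2)) ((X ×ˢ Y').image (fun p : A × A => p.1 + p.2))) :
    Disjoint ((Y ×ˢ X).image (fun p : A × A => p.1 - p.2)) ((Y' ×ˢ X').image (fun p : A × A => p.1 - p.2)) := by
  rw [disjoint_left]
  intro z hz hz'
  simp only [mem_image, mem_product, Prod.exists] at hz hz'
  obtain ⟨y, x, ⟨hy, hx⟩, rfl⟩ := hz
  obtain ⟨y', x', ⟨hy', hx'⟩, he⟩ := hz'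
  have key : x' + y = x + y' := by
    calc x' + y = y - x + x + x' := by abel
      _ = y' - x' + x + x' := by rw [he]
      _ = x + y' := by abel
  exact disjoint_left.1 h (mem_image.2 ⟨(x', y), mem_product.2 ⟨hx', hy⟩, rfl⟩)
    (by rw [key]; exact mem_image.2 ⟨(x, y'), mem_product.2 ⟨hx, hy'⟩, rfl⟩)

omit [AddCommGroup A] in
/-- Three pairwise disjoint sets of total size `|A| − 1` miss exactly one point. [folklore] -/
theorem exists_missed_point {P Q R : Finset A} (hPQ : Disjoint P Q) (hPR : Disjoint P R) (hQR : Disjoint Q R)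
    (hcard : P.card + Q.card + R.card + 1 = Fintype.card A) :
    ∃ x : A, univ \ (P ∪ Q ∪ R) = {x} := by
  have cW : (P ∪ Q ∪ R).card = P.card + Q.card + R.card := by
    rw [card_union_of_disjoint (disjoint_union_left.2 ⟨hPR, hQR⟩), card_union_of_disjoint hPQ]
  have hC : (univ \ (P ∪ Q ∪ R)).card = 1 := by rw [card_univ_sdiff, cW]; omega
  exact card_eq_one.1 hC

/-- A near-tiling by three sets: at every non-trivial character the three character sums add up to minus the value at
the missed point. [folklore] -/
theorem charsum_near_tiling' {P Q R : Finset A} (hPQ : Disjoint P Q) (hPR : Disjoint P R) (hQR : Disjoint Q R)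
    {x : A} (hx : univ \ (P ∪ Q ∪ R) = {x}) (ψ : AddChar A ℂ) (hψ : ψ ≠ 0) :
    (∑ a ∈ P, ψ a) + (∑ a ∈ Q, ψ a) + (∑ a ∈ R, ψ a) = -ψ x := by
  have hsplit : ∑ a, ψ a = (∑ a ∈ P ∪ Q ∪ R, ψ a) + ∑ a ∈ univ \ (P ∪ Q ∪ R), ψ a := by
    rw [← sum_union disjoint_sdiff, union_sdiff_of_subset (subset_univ _)]
  rw [AddChar.sum_eq_zero_iff_ne_zero.mpr hψ, hx, sum_singleton,
    sum_union (disjoint_union_left.2 ⟨hPR, hQR⟩), sum_union hPQ] at hsplit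
  linear_combination -hsplit

/-- **Structure theorem for domino cube law triples (additive form).**  `3 ∤ |A|`; `|T₀| = |T₁|`, `|U₀| = |U₁|`,
`3|T₀||U₀| + 1 = |A|`; the four sumsets `Tᵢ + Uⱼ` direct; `T₀+U₀, T₁+U₀, T₀+U₁` pairwise disjoint and
`T₁+U₁, T₀+U₁, T₁+U₀` pairwise disjoint.  Then `T₁ = κ − T₀` and `U₁ = κ′ − U₀` for some `κ, κ′`. [folklore] -/
theorem domino_structure (h3 : ¬ 3 ∣ Fintype.card A) {T₀ T₁ U₀ U₁ : Finset A}
    (hT : T₀.card = T₁.card) (hU : U₀.card = U₁.card) (hn : 3 * (T₀.card * U₀.card) + 1 = Fintype.card A)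
    (i₀₀ : Set.InjOn (fun p : A × A => p.1 + p.2) ↑(T₀ ×ˢ U₀))
    (i₁₀ : Set.InjOn (fun p : A × A => p.1 + p.2) ↑(T₁ ×ˢ U₀))
    (i₀₁ : Set.InjOn (fun p : A × A => p.1 + p.2) ↑(T₀ ×ˢ U₁))
    (i₁₁ : Set.InjOn (fun p : A × A => p.1 + p.2) ↑(T₁ ×ˢ U₁))
    (d₁ : Disjoint ((T₀ ×ˢ U₀).image (fun p : A × A => p.1 + p.2)) ((T₁ ×ˢ U₀).image (fun p : A × A => p.1 + p.2)))
    (d₂ : Disjoint ((T₀ ×ˢ U₀).image (fun p : A × A => p.1 + p.2)) ((T₀ ×ˢ U₁).image (fun p : A × A => p.1 + p.2)))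
    (d₃ : Disjoint ((T₁ ×ˢ U₀).image (fun p : A × A => p.1 + p.2)) ((T₀ ×ˢ U₁).image (fun p : A × A => p.1 + p.2)))
    (d₄ : Disjoint ((T₁ ×ˢ U₁).image (fun p : A × A => p.1 + p.2)) ((T₀ ×ˢ U₁).image (fun p : A × A => p.1 + p.2)))
    (d₅ : Disjoint ((T₁ ×ˢ U₁).image (fun p : A × A => p.1 + p.2)) ((T₁ ×ˢ U₀).image (fun p : A × A => p.1 + p.2))) :
    ∃ κ κ' : A, T₁ = T₀.image (fun b => κ - b) ∧ U₁ = U₀.image (fun b => κ' - b) := by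
  -- the four near-tilings and their missed points
  have c₀₀ := card_sumset₂ i₀₀; have c₁₀ := card_sumset₂ i₁₀; have c₀₁ := card_sumset₂ i₀₁; have c₁₁ := card_sumset₂ i₁₁
  have e₀₀ := card_diffset₂ i₀₀; have e₁₀ := card_diffset₂ i₁₀; have e₀₁ := card_diffset₂ i₀₁; have e₁₁ := card_diffset₂ i₁₁
  obtain ⟨x₀, hx₀⟩ := exists_missed_point d₁ d₂ d₃ (by rw [c₀₀, c₁₀, c₀₁, ← hT, ← hU]; omega)
  obtain ⟨x₇, hx₇⟩ := exists_missed_point d₄ d₅ d₃.symm (by rw [c₁₁, c₀₁, c₁₀, ← hT, ← hU]; omega)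
  -- difference-set near-tilings: (U₀−T₁, U₀−T₀, U₁−T₁) and (U₁−T₀, U₁−T₁, U₀−T₀)
  have f₁ := disjoint_diff_of_disjoint_sum (X := T₁) (X' := T₀) (Y := U₀) (Y' := U₀) d₁
  have f₂ := disjoint_diff_of_disjoint_sum (X := T₀) (X' := T₁) (Y := U₀) (Y' := U₁) d₃
  have f₃ := disjoint_diff_of_disjoint_sum (X := T₁) (X' := T₁) (Y := U₀) (Y' := U₁) d₅.symm
  have f₄ := disjoint_diff_of_disjoint_sum (X := T₀) (X' := T₁) (Y := U₁) (Y' := U₁) d₄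
  have f₅ := disjoint_diff_of_disjoint_sum (X := T₁) (X' := T₀) (Y := U₁) (Y' := U₀) d₃.symm
  have f₆ := disjoint_diff_of_disjoint_sum (X := T₀) (X' := T₀) (Y := U₁) (Y' := U₀) d₂.symm
  obtain ⟨y₀, hy₀⟩ := exists_missed_point f₁ f₃ f₂ (by rw [e₁₀, e₀₀, e₁₁, ← hT, ← hU]; omega)
  obtain ⟨y₇, hy₇⟩ := exists_missed_point f₄ f₆ f₅ (by rw [e₀₁, e₁₁, e₀₀, ← hT, ← hU]; omega)
  have key := domino_structure_of_charsums h3 hT hU (x₀ := x₀) (x₇ := x₇) (y₀ := y₀) (y₇ := y₇)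
    (fun ψ hψ => by
      have := charsum_near_tiling' d₁ d₂ d₃ hx₀ ψ hψ
      rw [charsum_sumset₂ ψ i₀₀, charsum_sumset₂ ψ i₁₀, charsum_sumset₂ ψ i₀₁] at this
      linear_combination this)
    (fun ψ hψ => by
      have := charsum_near_tiling' d₄ d₅ d₃.symm hx₇ ψ hψ
      rw [charsum_sumset₂ ψ i₁₁, charsum_sumset₂ ψ i₁₀, charsum_sumset₂ ψ i₀₁] at this
      linear_combination this)
    (fun ψ hψ => by
      have := charsum_near_tiling' f₁ f₃ f₂ hy₀ ψ hψ
      rw [charsum_diffset₂ ψ i₁₀, charsum_diffset₂ ψ i₀₀, charsum_diffset₂ ψ i₁₁] at this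
      linear_combination this)
    (fun ψ hψ => by
      have := charsum_near_tiling' f₄ f₆ f₅ hy₇ ψ hψ
      rw [charsum_diffset₂ ψ i₀₁, charsum_diffset₂ ψ i₁₁, charsum_diffset₂ ψ i₀₀] at this
      linear_combination this)
  exact ⟨x₀ - y₀, x₀ + y₇, key.1, key.2⟩

end Additive

end Summit.MatrixMultiplication.OmegaCensus
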